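import Mathlib
import Literature.Analysis.FluidPDE.VectorCalculus
import Summits.NavierStokesRegularity.NavierStokesRegularity.Theorems.UnthreadedDoorFluxStarvedDipoleSphereFrame
import Summits.NavierStokesRegularity.NavierStokesRegularity.Theorems.UnthreadedDoorFluxStarvedDipoleLoopLaw
import HarnessLib

/-!
# Route `UnthreadedDoor`, crux `PoloidalLiouville` (stmt-NavierStokesRegularity-1222), wall W1 — crux idea
# «flux-starved-dipoles» (ns-idea-15 g12/g13, `Cruxes/PoloidalLiouville/FluxStarvedDipoleSketch.lean`):
# the LATITUDE-INDEPENDENCE IDENTITY `(a − r a′)·M = −r²ℓ` (card §Proof step 3; last input of `FluxStarvationSteady`)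

Setting (all sketch shapes unfolded, as in `…FluxStarvedDipoleLoopLaw` p837304): `u ∈ C¹(ℝ³; ℝ³)` divergence-free,
`A, R ∈ C³(0,∞)`, the turning-axis dipole potential `T(x) = ⟪A(‖x−x₀‖), x−x₀⟫/‖x−x₀‖ + R(‖x−x₀‖)` and the STEADY KINEMATIC LAW
`∇(⟪u,∇T⟫ − ΔT) × (x−x₀) = ∇⟪u, x−x₀⟫ × ∇T` off the centre; `r > 0` with `A(r) = a·n ≠ 0`.  On `S_r(x₀)`:
`∇T = A(r)/r + κ y` (`dipole_gradient_sphere`), `⟪∇T, y⟫ = ⟪A′(r), y⟫ + rR′(r)` (`dipole_fderiv_radial`),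
`ΔT(x₀ + y) = ⟪Cv, y⟫ + D` (`dipole_laplacian_sphere`).  Three steps, each POINTWISE on the sphere:

* `meridional_identity` — differentiate `a sin θ·u_θ = ⟪∇T, y⟫ m/r − r L − r ΔT` (`L = ⟪u,∇T⟫ − ΔT`, `m = ⟪u, x−x₀⟫`)
  along a meridian `θ ↦ x₀ + r cos θ·n + r sin θ·ρ` and eliminate `DL[θ̂]` with the azimuthal component of the law:
  `a cos θ·u_θ + a sin θ·(r⟪θ̂, Du θ̂⟫ − u_ξ) = ⟪A′(r), θ̂⟫ m − a sin θ·Dm[ξ̂] − r²⟪Cv, θ̂⟫`;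
* `azimuthal_identity` — with `div u = ⟪ξ̂,Du ξ̂⟫ + ⟪θ̂,Du θ̂⟫ + ⟪φ̂,Du φ̂⟫ = 0` the radial derivative `Dm[ξ̂]` cancels:
  `a r sin θ·⟪φ̂, Du φ̂⟫ = a cos θ·u_θ − ⟪A′(r), θ̂⟫ m + r²⟪Cv, θ̂⟫`;
* `latitude_identity` — along the latitude circle of colatitude `θ` (`sin θ ≠ 0`), `d/dφ ⟪u, φ̂⟫ = r sin θ⟪φ̂,Du φ̂⟫ − ⟪u, ρ̂⟫`,
  the loop momentum is a constant `M` (`loopMomentum_const_on_latitudeCircle`), so `r a·d/dφ ⟪u, φ̂⟫ = K₀ + K₁ cos φ + K₂ sin φ`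
  with `K₀ = sin θ·(−aM + r⟪A′,n⟫M − r³⟪Cv,n⟫)`; integrating over `[0, 2π]`: ★ `(a − r⟪A′(r), n⟫)·M = −r³⟪Cv, n⟫`
  (`= −r²ℓ`, `ℓ = ⟪A″ + (2/r)A′ − (2/r²)A, Â⟫`, in a radial frame), independent of the latitude.

The sequel `…FluxStarvedDipoleFluxStarvation` turns ★ into `FluxStarvationSteady` and K1 `DipoleNeverSteady` (unconditional).
HONEST LABEL: the dipole stratum of the LINEAR kinematic shadow of W1 (critic V28: information-grade, W1 movement 0);
`PoloidalLiouville` (1222), its wall `stub_scalarLiouville` and the summit stay OPEN; NO Navier–Stokes regularity statement is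
proved.  `--supports stmt-NavierStokesRegularity-1222` (helper).  [folklore]
-/

noncomputable section

-- the summit and its single sub-problem share the name (CONVENTIONS §1)
set_option linter.dupNamespace false

open Set Filter Topology InnerProductSpace
open scoped RealInnerProductSpace Laplacian
open Literature.Analysis.FluidPDE
open Summit.NavierStokesRegularity.NavierStokesRegularity.Theorems.PoloidalLiouville.HorizonTower (E3)
open Summit.NavierStokesRegularity.NavierStokesRegularity.Theorems.PoloidalLiouville.KinematicShadow (PointSource.cross_smul_right
  PointSource.cross_add_right PointSource.cross_self PointSource.cross_anticomm)
open Summit.NavierStokesRegularity.NavierStokesRegularity.Theorems.PoloidalLiouville.HorizonTower.Zonal (inner_cross_self_left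
  inner_cross_self_right norm_cross_sq cross_cross_left_of_orthonormal cross_cross_right_of_orthonormal frameBasis
  frameBasis_apply frameVec_zero frameVec_one frameVec_two)

namespace Summit.NavierStokesRegularity.NavierStokesRegularity.Theorems.PoloidalLiouville.FluxStarvedDipole

/-! ### The meridional identity -/

/-- **MERIDIONAL IDENTITY** (θ-derivative of the reduced scalar law along a meridian of a dipolar sphere).  Setting: `u ∈ C¹`,
`A, R ∈ C³(0,∞)`, the dipole potential `T` and the steady kinematic law off the centre (sketch shapes, unfolded); `r > 0`,
`A(r) = a·n ≠ 0` with `n` a unit vector, `ρ ⊥ n` a unit vector, `ΔT(x₀ + y) = ⟪Cv, y⟫ + D` on `S_r` (`dipole_laplacian_sphere`);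
the point `x = x₀ + y`, `y = r cos θ·n + r sin θ·ρ`, with frame `ξ̂ = cos θ·n + sin θ·ρ`, `θ̂ = −sin θ·n + cos θ·ρ`.  Then
`a cos θ·u_θ + a sin θ·(r⟪θ̂, Du θ̂⟫ − u_ξ) = ⟪A′(r), θ̂⟫·m − a sin θ·Dm[ξ̂] − r²⟪Cv, θ̂⟫` (`m = ⟪u, x − x₀⟫`).
Proof: along the meridian, `a sin θ·u_θ = ⟪∇T, y⟫ m/r − r L − r ΔT` (`meridional_drift`, `∇T = A(r)/r + κy`); differentiate
both sides in `θ` (`⟪∇T, y⟫ = ⟪A′(r), y⟫ + rR′(r)` by `dipole_fderiv_radial`), and eliminate `DL[θ̂]` with the azimuthal component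
of the law (`law_azimuthal`). [folklore] -/
theorem meridional_identity (u : E3 → E3) (x₀ : E3) (A : ℝ → E3) (R : ℝ → ℝ)
    (hu : ContDiff ℝ 1 u) (hA : ContDiffOn ℝ 3 A (Set.Ioi 0)) (hR : ContDiffOn ℝ 3 R (Set.Ioi 0))
    (hlaw : ∀ x ∈ ({x₀}ᶜ : Set E3),
      cross (gradient (fun z => ⟪u z, gradient (fun x => ⟪A ‖x - x₀‖, x - x₀⟫ / ‖x - x₀‖ + R ‖x - x₀‖) z⟫
          - Δ (fun x => ⟪A ‖x - x₀‖, x - x₀⟫ / ‖x - x₀‖ + R ‖x - x₀‖) z) x) (x - x₀)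
        = cross (gradient (fun z => ⟪u z, z - x₀⟫) x)
            (gradient (fun x => ⟪A ‖x - x₀‖, x - x₀⟫ / ‖x - x₀‖ + R ‖x - x₀‖) x))
    {r : ℝ} (hr : 0 < r) {n ρ : E3} (hn : ‖n‖ = 1) (hAn : A r = ‖A r‖ • n) (hρ : ‖ρ‖ = 1)
    (hnρ : ⟪n, ρ⟫ = 0) {Cv : E3} {D : ℝ}
    (hQ : ∀ y : E3, ‖y‖ = r →
      Δ (fun x => ⟪A ‖x - x₀‖, x - x₀⟫ / ‖x - x₀‖ + R ‖x - x₀‖) (x₀ + y) = ⟪Cv, y⟫ + D)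
    (θ : ℝ) {x ξ τ : E3} (hx : x = x₀ + ((r * Real.cos θ) • n + (r * Real.sin θ) • ρ))
    (hξ : ξ = Real.cos θ • n + Real.sin θ • ρ) (hτ : τ = (-Real.sin θ) • n + Real.cos θ • ρ) :
    ‖A r‖ * Real.cos θ * ⟪u x, τ⟫ + ‖A r‖ * Real.sin θ * (r * ⟪τ, fderiv ℝ u x τ⟫ - ⟪u x, ξ⟫)
      = ⟪deriv A r, τ⟫ * ⟪u x, x - x₀⟫ - ‖A r‖ * Real.sin θ * fderiv ℝ (fun z => ⟪u z, z - x₀⟫) x ξ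
        - r ^ 2 * ⟪Cv, τ⟫ := by
  set a : ℝ := ‖A r‖ with ha
  set T : E3 → ℝ := fun x => ⟪A ‖x - x₀‖, x - x₀⟫ / ‖x - x₀‖ + R ‖x - x₀‖ with hTdef
  have hT : ∀ z, T z = ⟪A ‖z - x₀‖, z - x₀⟫ / ‖z - x₀‖ + R ‖z - x₀‖ := fun z => rfl
  set m : E3 → ℝ := fun z => ⟪u z, z - x₀⟫ with hmdef
  set L : E3 → ℝ := fun z => ⟪u z, gradient T z⟫ - Δ T z with hLdef
  -- the meridian, its points, its frame
  set yv : ℝ → E3 := fun θ' => (r * Real.cos θ') • n + (r * Real.sin θ') • ρ with hyv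
  set β : ℝ → E3 := fun θ' => x₀ + yv θ' with hβ
  set τf : ℝ → E3 := fun θ' => (-Real.sin θ') • n + Real.cos θ' • ρ with hτf
  have hβx : β θ = x := by rw [hx]
  have hτθ : τf θ = τ := by rw [hτ]
  have hβy : ∀ θ', β θ' - x₀ = yv θ' := fun θ' => add_sub_cancel_left _ _
  have hyn : ∀ θ', ‖yv θ'‖ = r := fun θ' => norm_meridianVec hn hρ hnρ hr.le θ'
  have hβne : ∀ θ', β θ' ≠ x₀ := by
    intro θ' h
    have h1 := hyn θ'
    rw [← hβy, h, sub_self, norm_zero] at h1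
    exact hr.ne h1
  have hβ' : ∀ θ', HasDerivAt β (r • τf θ') θ' := fun θ' => (hasDerivAt_meridianVec n ρ r θ').const_add x₀
  have hτ' : ∀ θ', HasDerivAt τf (-(Real.cos θ' • n + Real.sin θ' • ρ)) θ' := fun θ' => hasDerivAt_thetaHat n ρ θ'
  -- differentiability of `m` everywhere and of `L` off the centre
  have hmd : ∀ z, DifferentiableAt ℝ m z := fun z =>
    (hu.differentiable one_ne_zero z).inner ℝ (differentiableAt_id.sub (differentiableAt_const x₀))
  have hLd : ∀ z, z ≠ x₀ → DifferentiableAt ℝ L z := by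
    intro z hz
    have h3 := dipole_contDiffAt hT hA hR hz
    exact ((hu.differentiable one_ne_zero z).inner ℝ (dipole_differentiableAt_gradient h3)).sub
      (dipole_differentiableAt_laplacian h3)
  -- `∇T` on the sphere, the radial derivative `⟪∇T, y⟫`, and `ΔT` along the meridian
  have hGT : ∀ θ', ∃ κ : ℝ, gradient T (β θ') = (r⁻¹ * a) • n + κ • yv θ' := by
    intro θ'
    obtain ⟨κ, hκ⟩ := dipole_gradient_sphere (x₀ := x₀) hT hA hR hr (hyn θ')
    exact ⟨κ, by rw [hκ, hAn, smul_smul]⟩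
  have hEr : ∀ θ', ⟪gradient T (β θ'), yv θ'⟫ = ⟪deriv A r, yv θ'⟫ + r * deriv R r := by
    intro θ'
    rw [HorizonTower.inner_gradient_eq_fderiv, ← hβy, dipole_fderiv_radial hT hA hR (hβne θ'), hβy, hyn]
  have hQ' : ∀ θ', Δ T (β θ') = ⟪Cv, yv θ'⟫ + D := fun θ' => hQ _ (hyn θ')
  -- the pointwise identity `a sin θ' u_θ = ⟪∇T,y⟫ m / r − r L − r ΔT` (times `r`)
  have hpt : ∀ θ', r * (a * Real.sin θ' * ⟪u (β θ'), τf θ'⟫) =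
      (⟪deriv A r, yv θ'⟫ + r * deriv R r) * m (β θ') - r * (r * L (β θ')) - r * (r * (⟪Cv, yv θ'⟫ + D)) := by
    intro θ'
    obtain ⟨κ, hκ⟩ := hGT θ'
    have hmd' : r * (r * ⟪u (β θ'), (r⁻¹ * a) • n + κ • yv θ'⟫) =
        ⟪(r⁻¹ * a) • n + κ • yv θ', yv θ'⟫ * ⟪u (β θ'), yv θ'⟫ - r * (r * (r⁻¹ * a) * Real.sin θ' * ⟪u (β θ'), τf θ'⟫) :=
      meridional_drift hn hρ hnρ (Real.cos_sq_add_sin_sq θ') r (r⁻¹ * a) κ (u (β θ'))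
    have hra : r * (r⁻¹ * a) = a := by field_simp
    rw [hra] at hmd'
    have hLval : L (β θ') = ⟪u (β θ'), gradient T (β θ')⟫ - Δ T (β θ') := rfl
    have hm : m (β θ') = ⟪u (β θ'), yv θ'⟫ := by simp only [hmdef, hβy]
    rw [hLval, hQ', ← hEr θ', hκ, hm]
    linear_combination hmd'
  -- (a) the derivative of `θ' ↦ r·a sin θ'·u_θ` by the kinematic chain rule
  have hUτ : HasDerivAt (fun θ' => ⟪u (β θ'), τf θ'⟫)
      (⟪u (β θ), -(Real.cos θ • n + Real.sin θ • ρ)⟫ + ⟪fderiv ℝ u (β θ) (r • τf θ), τf θ⟫) θ := by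
    have hU : HasDerivAt (fun θ' => u (β θ')) (fderiv ℝ u (β θ) (r • τf θ)) θ :=
      (hu.differentiable one_ne_zero (β θ)).hasFDerivAt.comp_hasDerivAt θ (hβ' θ)
    exact hU.inner ℝ (hτ' θ)
  have hg1 : HasDerivAt (fun θ' => r * (a * Real.sin θ' * ⟪u (β θ'), τf θ'⟫))
      (r * (a * Real.cos θ * ⟪u (β θ), τf θ⟫ + a * Real.sin θ *
        (⟪u (β θ), -(Real.cos θ • n + Real.sin θ • ρ)⟫ + ⟪fderiv ℝ u (β θ) (r • τf θ), τf θ⟫))) θ := by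
    have hs : HasDerivAt (fun θ' => a * Real.sin θ') (a * Real.cos θ) θ := (Real.hasDerivAt_sin θ).const_mul a
    exact (hs.mul hUτ).const_mul r
  -- (b) the derivative of the right-hand side
  have hyv' : HasDerivAt yv (r • τf θ) θ := hasDerivAt_meridianVec n ρ r θ
  have hmD : HasDerivAt (fun θ' => m (β θ')) (fderiv ℝ m (β θ) (r • τf θ)) θ :=
    (hmd (β θ)).hasFDerivAt.comp_hasDerivAt θ (hβ' θ)
  have hLD : HasDerivAt (fun θ' => L (β θ')) (fderiv ℝ L (β θ) (r • τf θ)) θ :=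
    (hLd (β θ) (hβne θ)).hasFDerivAt.comp_hasDerivAt θ (hβ' θ)
  have hED : HasDerivAt (fun θ' => ⟪deriv A r, yv θ'⟫ + r * deriv R r) (⟪deriv A r, r • τf θ⟫) θ := by
    have h := ((hasDerivAt_const θ (deriv A r)).inner ℝ hyv').add_const (r * deriv R r)
    simpa only [inner_zero_left, zero_add, add_zero] using h
  have hQD : HasDerivAt (fun θ' => ⟪Cv, yv θ'⟫ + D) (⟪Cv, r • τf θ⟫) θ := by
    have h := ((hasDerivAt_const θ Cv).inner ℝ hyv').add_const D
    simpa only [inner_zero_left, zero_add, add_zero] using h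
  have hg2 : HasDerivAt (fun θ' => (⟪deriv A r, yv θ'⟫ + r * deriv R r) * m (β θ') - r * (r * L (β θ'))
        - r * (r * (⟪Cv, yv θ'⟫ + D)))
      (⟪deriv A r, r • τf θ⟫ * m (β θ) + (⟪deriv A r, yv θ⟫ + r * deriv R r) * fderiv ℝ m (β θ) (r • τf θ)
        - r * (r * fderiv ℝ L (β θ) (r • τf θ)) - r * (r * ⟪Cv, r • τf θ⟫)) θ :=
    ((hED.mul hmD).sub ((hLD.const_mul r).const_mul r)).sub ((hQD.const_mul r).const_mul r)
  -- (c) the two functions coincide, hence so do the derivatives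
  have hfun : (fun θ' => r * (a * Real.sin θ' * ⟪u (β θ'), τf θ'⟫)) =
      fun θ' => (⟪deriv A r, yv θ'⟫ + r * deriv R r) * m (β θ') - r * (r * L (β θ')) - r * (r * (⟪Cv, yv θ'⟫ + D)) :=
    funext hpt
  rw [hfun] at hg1
  have huniq := hg1.unique hg2
  -- (d) the azimuthal component of the law at `x`
  have hxne : x ≠ x₀ := by rw [← hβx]; exact hβne θ
  obtain ⟨κ, hκ⟩ := hGT θ
  have hE := hlaw x hxne
  have hxy : x - x₀ = yv θ := by rw [← hβx]; exact hβy θ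
  rw [hxy, ← hβx, hκ] at hE
  have hB := law_azimuthal hn hρ hnρ (Real.cos_sq_add_sin_sq θ) r (r⁻¹ * a) κ (gradient L (β θ)) (gradient m (β θ)) hE
  rw [← hκ, hEr θ, HorizonTower.inner_gradient_eq_fderiv, HorizonTower.inner_gradient_eq_fderiv,
    HorizonTower.inner_gradient_eq_fderiv] at hB
  have hra : r * (r⁻¹ * a) = a := by field_simp
  rw [hra] at hB
  -- (e) assemble
  rw [map_smul, map_smul, map_smul, inner_smul_left, inner_smul_right, inner_smul_right, inner_neg_right] at huniq
  simp only [smul_eq_mul] at huniq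
  rw [hβx, hτθ, ← hξ] at huniq
  rw [← hτ, ← hξ, hβx] at hB
  have hmx : m x = ⟪u x, x - x₀⟫ := rfl
  rw [← hmx]
  rw [real_inner_comm (τ : E3) (fderiv ℝ u x τ)] at huniq
  have hr0 : r ≠ 0 := hr.ne'
  -- `huniq`: r(a cos θ u_θ + a sin θ (r⟪Du τ,τ⟫ − u_ξ)) = r⟪A′,τ⟫ m + Er·r·Dm τ − r·r·(r DL τ) − r·r·r⟪Cv,τ⟫
  -- `hB`   : r·r·DL τ = Er·Dm τ + a sin θ·Dm ξ
  have key : r * (a * Real.cos θ * ⟪u x, τ⟫ + a * Real.sin θ * (r * ⟪τ, fderiv ℝ u x τ⟫ - ⟪u x, ξ⟫))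
      = r * (⟪deriv A r, τ⟫ * m x - a * Real.sin θ * fderiv ℝ m x ξ - r ^ 2 * ⟪Cv, τ⟫) := by
    linear_combination huniq - r * hB
  exact mul_left_cancel₀ hr0 key

/-! ### The azimuthal strain identity (pointwise incompressibility in the moving frame) -/

/-- **AZIMUTHAL STRAIN IDENTITY.**  In the setting of `meridional_identity`, if moreover `div u = 0`, then at the point
`x = x₀ + r cos θ·n + r sin θ·ρ` the azimuthal strain `⟪φ̂, Du φ̂⟫` (`φ̂ = n × ρ`) satisfies
`a·r sin θ·⟪φ̂, Du φ̂⟫ = a cos θ·u_θ − ⟪A′(r), θ̂⟫·m + r²⟪Cv, θ̂⟫`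
(`div u = ⟪ξ̂,Du ξ̂⟫ + ⟪θ̂,Du θ̂⟫ + ⟪φ̂,Du φ̂⟫`, the radial strain is `(Dm[ξ̂] − u_ξ)/r`, the meridional one comes from
`meridional_identity`; the radial derivative `Dm[ξ̂]` cancels). [folklore] -/
theorem azimuthal_identity (u : E3 → E3) (x₀ : E3) (A : ℝ → E3) (R : ℝ → ℝ)
    (hu : ContDiff ℝ 1 u) (hdiv : Literature.Analysis.FluidPDE.VectorCalculus.IsDivFree u)
    (hA : ContDiffOn ℝ 3 A (Set.Ioi 0)) (hR : ContDiffOn ℝ 3 R (Set.Ioi 0))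
    (hlaw : ∀ x ∈ ({x₀}ᶜ : Set E3),
      cross (gradient (fun z => ⟪u z, gradient (fun x => ⟪A ‖x - x₀‖, x - x₀⟫ / ‖x - x₀‖ + R ‖x - x₀‖) z⟫
          - Δ (fun x => ⟪A ‖x - x₀‖, x - x₀⟫ / ‖x - x₀‖ + R ‖x - x₀‖) z) x) (x - x₀)
        = cross (gradient (fun z => ⟪u z, z - x₀⟫) x)
            (gradient (fun x => ⟪A ‖x - x₀‖, x - x₀⟫ / ‖x - x₀‖ + R ‖x - x₀‖) x))
    {r : ℝ} (hr : 0 < r) {n ρ : E3} (hn : ‖n‖ = 1) (hAn : A r = ‖A r‖ • n) (hρ : ‖ρ‖ = 1)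
    (hnρ : ⟪n, ρ⟫ = 0) {Cv : E3} {D : ℝ}
    (hQ : ∀ y : E3, ‖y‖ = r →
      Δ (fun x => ⟪A ‖x - x₀‖, x - x₀⟫ / ‖x - x₀‖ + R ‖x - x₀‖) (x₀ + y) = ⟪Cv, y⟫ + D)
    (θ : ℝ) {x ξ τ : E3} (hx : x = x₀ + ((r * Real.cos θ) • n + (r * Real.sin θ) • ρ))
    (hξ : ξ = Real.cos θ • n + Real.sin θ • ρ) (hτ : τ = (-Real.sin θ) • n + Real.cos θ • ρ) :
    ‖A r‖ * (r * Real.sin θ) * ⟪cross n ρ, fderiv ℝ u x (cross n ρ)⟫ =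
      ‖A r‖ * Real.cos θ * ⟪u x, τ⟫ - ⟪deriv A r, τ⟫ * ⟪u x, x - x₀⟫ + r ^ 2 * ⟪Cv, τ⟫ := by
  have hM := meridional_identity u x₀ A R hu hA hR hlaw hr hn hAn hρ hnρ hQ θ hx hξ hτ
  subst hξ hτ
  obtain ⟨hξ1, hτ1, hξτ, hp⟩ := movingFrame_facts hn hρ hnρ (Real.cos_sq_add_sin_sq θ)
  have hdiv0 := hdiv x
  rw [divergence_pairFrame u x hξ1 hτ1 hξτ, hp] at hdiv0
  -- the radial strain through the loop momentum: `Dm[ξ̂] = r⟪ξ̂, Du ξ̂⟫ + u_ξ`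
  have hxξ : x - x₀ = r • (Real.cos θ • n + Real.sin θ • ρ) := by
    rw [hx, add_sub_cancel_left, smul_add, smul_smul, smul_smul]
  have hmξ : fderiv ℝ (fun z => ⟪u z, z - x₀⟫) x (Real.cos θ • n + Real.sin θ • ρ) =
      r * ⟪Real.cos θ • n + Real.sin θ • ρ, fderiv ℝ u x (Real.cos θ • n + Real.sin θ • ρ)⟫
        + ⟪u x, Real.cos θ • n + Real.sin θ • ρ⟫ := by
    have h1 : HasFDerivAt u (fderiv ℝ u x) x := (hu.differentiable one_ne_zero x).hasFDerivAt
    have h2 : HasFDerivAt (fun z : E3 => z - x₀) (ContinuousLinearMap.id ℝ E3) x := (hasFDerivAt_id x).sub_const x₀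
    rw [(h1.inner ℝ h2).fderiv]
    simp only [ContinuousLinearMap.coe_comp, Function.comp_apply, ContinuousLinearMap.prod_apply,
      fderivInnerCLM_apply, ContinuousLinearMap.coe_id', id_eq]
    rw [hxξ, inner_smul_right,
      real_inner_comm (Real.cos θ • n + Real.sin θ • ρ) (fderiv ℝ u x (Real.cos θ • n + Real.sin θ • ρ))]
    ring
  linear_combination (‖A r‖ * (r * Real.sin θ)) * hdiv0 - hM + ‖A r‖ * Real.sin θ * hmξ

/-! ### The latitude-independence identity (incompressibility averaged over a latitude circle) -/

/-- **LATITUDE-INDEPENDENCE IDENTITY** (crux card «flux-starved-dipoles», §Proof step 3, the identity `(a − r a′)·M = −r²ℓ`).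
Setting: `u ∈ C¹` divergence-free, `A, R ∈ C³(0,∞)`, the steady kinematic law for the dipole potential off the centre, `r > 0`,
`A(r) = a·n`, `a = ‖A(r)‖ ≠ 0`, `e ⊥ n` a unit vector, `ΔT(x₀ + y) = ⟪Cv, y⟫ + D` on `S_r`.  On the NON-POLAR latitude circle of
colatitude `θ` (`sin θ ≠ 0`) the loop momentum `M = ⟪u, x − x₀⟫` (constant there by the loop law) satisfies
`(a − r⟪A′(r), n⟫)·M = −r³⟪Cv, n⟫` — independent of `θ`.
Proof: along the circle `φ ↦ x₀ + r cos θ·n + r sin θ·(cos φ·e + sin φ·(n × e))`, `d/dφ ⟪u, φ̂⟫ = r sin θ⟪φ̂, Du φ̂⟫ − ⟪u, ρ̂⟫`;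
by `azimuthal_identity` and the loop law, `r a·d/dφ ⟪u, φ̂⟫ = K₀ + K₁ cos φ + K₂ sin φ` with
`K₀ = sin θ·(−aM + r⟪A′,n⟫M − r³⟪Cv,n⟫)`; integrating over `[0, 2π]` gives `K₀ = 0`. [folklore] -/
theorem latitude_identity (u : E3 → E3) (x₀ : E3) (A : ℝ → E3) (R : ℝ → ℝ)
    (hu : ContDiff ℝ 1 u) (hdiv : Literature.Analysis.FluidPDE.VectorCalculus.IsDivFree u)
    (hA : ContDiffOn ℝ 3 A (Set.Ioi 0)) (hR : ContDiffOn ℝ 3 R (Set.Ioi 0))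
    (hlaw : ∀ x ∈ ({x₀}ᶜ : Set E3),
      cross (gradient (fun z => ⟪u z, gradient (fun x => ⟪A ‖x - x₀‖, x - x₀⟫ / ‖x - x₀‖ + R ‖x - x₀‖) z⟫
          - Δ (fun x => ⟪A ‖x - x₀‖, x - x₀⟫ / ‖x - x₀‖ + R ‖x - x₀‖) z) x) (x - x₀)
        = cross (gradient (fun z => ⟪u z, z - x₀⟫) x)
            (gradient (fun x => ⟪A ‖x - x₀‖, x - x₀⟫ / ‖x - x₀‖ + R ‖x - x₀‖) x))
    {r : ℝ} (hr : 0 < r) (hAr : A r ≠ 0) {n e : E3} (hn : ‖n‖ = 1) (hAn : A r = ‖A r‖ • n) (he : ‖e‖ = 1)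
    (hne : ⟪n, e⟫ = 0) {Cv : E3} {D : ℝ}
    (hQ : ∀ y : E3, ‖y‖ = r →
      Δ (fun x => ⟪A ‖x - x₀‖, x - x₀⟫ / ‖x - x₀‖ + R ‖x - x₀‖) (x₀ + y) = ⟪Cv, y⟫ + D)
    {θ : ℝ} (hθ : Real.sin θ ≠ 0) :
    (‖A r‖ - r * ⟪deriv A r, n⟫) *
        ⟪u (x₀ + ((r * Real.cos θ) • n + (r * Real.sin θ) • e)), (r * Real.cos θ) • n + (r * Real.sin θ) • e⟫
      = -(r ^ 3 * ⟪Cv, n⟫) := by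
  set a : ℝ := ‖A r‖ with ha
  have ha0 : a ≠ 0 := norm_ne_zero_iff.mpr hAr
  set c : ℝ := Real.cos θ with hc
  set s : ℝ := Real.sin θ with hs
  have hcs : c ^ 2 + s ^ 2 = 1 := Real.cos_sq_add_sin_sq θ
  -- the frame `(n, e, n × e)`
  obtain ⟨hf1, hfn, hfe, hnf, -⟩ := pairFrame_facts hn he hne
  have hnf' : ⟪n, cross n e⟫ = 0 := by rw [real_inner_comm]; exact hfn
  have hef' : ⟪e, cross n e⟫ = 0 := by rw [real_inner_comm]; exact hfe
  -- the rotating unit vectors `ρ̂(φ)`, `φ̂(φ)`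
  set ρf : ℝ → E3 := fun φ => Real.cos φ • e + Real.sin φ • cross n e with hρf
  set pf : ℝ → E3 := fun φ => (-Real.sin φ) • e + Real.cos φ • cross n e with hpf
  have hρ1 : ∀ φ, ‖ρf φ‖ = 1 := fun φ => (movingFrame_facts he hf1 hef' (Real.cos_sq_add_sin_sq φ)).1
  have hnρ : ∀ φ, ⟪n, ρf φ⟫ = 0 := fun φ => by
    simp only [hρf, inner_add_right, inner_smul_right, hne, hnf', mul_zero, add_zero]
  have hnρx : ∀ φ, cross n (ρf φ) = pf φ := fun φ => by
    simp only [hρf, hpf, PointSource.cross_add_right, PointSource.cross_smul_right, hnf]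
    module
  have hpf' : ∀ φ, HasDerivAt pf (-(Real.cos φ • e + Real.sin φ • cross n e)) φ := fun φ =>
    hasDerivAt_thetaHat e (cross n e) φ
  -- the latitude circle and the loop momentum on it
  set γ : ℝ → E3 := fun φ => x₀ + (r * c) • n + (r * s) • (Real.cos φ • e + Real.sin φ • cross n e) with hγ
  have hγ' : ∀ φ, HasDerivAt γ ((r * s) • pf φ) φ := fun φ => hasDerivAt_latitudeCircle n e x₀ r c s φ
  have hγx : ∀ φ, γ φ = x₀ + ((r * c) • n + (r * s) • ρf φ) := fun φ => add_assoc _ _ _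
  have hγy : ∀ φ, γ φ - x₀ = r • (c • n + s • ρf φ) := fun φ => by
    rw [hγx, add_sub_cancel_left]; simp only [hρf]; module
  set M : ℝ := ⟪u (x₀ + ((r * c) • n + (r * s) • e)), (r * c) • n + (r * s) • e⟫ with hM
  have hn' : ‖A r‖⁻¹ • A r = n := by
    nth_rewrite 2 [hAn]
    rw [smul_smul, inv_mul_cancel₀ ha0, one_smul]
  have hAe : ⟪A r, e⟫ = 0 := by rw [hAn, real_inner_smul_left, hne, mul_zero]
  have hγ0 : γ 0 = x₀ + ((r * c) • n + (r * s) • e) := by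
    rw [hγx]; simp only [hρf, Real.cos_zero, Real.sin_zero, one_smul, zero_smul, add_zero]
  have hm : ∀ φ, ⟪u (γ φ), γ φ - x₀⟫ = M := by
    intro φ
    have h : ⟪u (γ φ), γ φ - x₀⟫ = ⟪u (γ 0), γ 0 - x₀⟫ := by
      have h0 := loopMomentum_const_on_latitudeCircle u x₀ A R hu hA hR hlaw hr hAr he hAe hcs φ 0
      rw [hn'] at h0
      exact h0
    rw [h, hγ0, add_sub_cancel_left]
  have hMξ : ∀ φ, r * ⟪u (γ φ), c • n + s • ρf φ⟫ = M := fun φ => by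
    rw [← hm φ, hγy, inner_smul_right]
  -- the azimuthal strain identity at each point of the circle
  have hP : ∀ φ, a * (r * s) * ⟪pf φ, fderiv ℝ u (γ φ) (pf φ)⟫ =
      a * c * ⟪u (γ φ), (-s) • n + c • ρf φ⟫ - ⟪deriv A r, (-s) • n + c • ρf φ⟫ * M
        + r ^ 2 * ⟪Cv, (-s) • n + c • ρf φ⟫ := by
    intro φ
    have h := azimuthal_identity u x₀ A R hu hdiv hA hR hlaw hr hn hAn (hρ1 φ) (hnρ φ) hQ θ (hγx φ) rfl rfl
    rw [hnρx, hm] at h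
    exact h
  -- the derivative of `φ ↦ r a ⟪u, φ̂⟫` along the circle is `K₀ + K₁ cos φ + K₂ sin φ`
  set K₀ : ℝ := s * (-(a * M) + r * ⟪deriv A r, n⟫ * M - r ^ 3 * ⟪Cv, n⟫) with hK₀
  set K₁ : ℝ := r * c * (-(⟪deriv A r, e⟫ * M) + r ^ 2 * ⟪Cv, e⟫) with hK₁
  set K₂ : ℝ := r * c * (-(⟪deriv A r, cross n e⟫ * M) + r ^ 2 * ⟪Cv, cross n e⟫) with hK₂
  have hderiv : ∀ φ, HasDerivAt (fun φ => r * (a * ⟪u (γ φ), pf φ⟫)) (K₀ + K₁ * Real.cos φ + K₂ * Real.sin φ) φ := by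
    intro φ
    have hU : HasDerivAt (fun φ => u (γ φ)) (fderiv ℝ u (γ φ) ((r * s) • pf φ)) φ :=
      (hu.differentiable one_ne_zero (γ φ)).hasFDerivAt.comp_hasDerivAt φ (hγ' φ)
    have h := ((hU.inner ℝ (hpf' φ)).const_mul a).const_mul r
    refine h.congr_deriv ?_
    have hρdec : Real.cos φ • e + Real.sin φ • cross n e
        = s • (c • n + s • ρf φ) + c • ((-s) • n + c • ρf φ) := by
      have h1 : s • (c • n + s • ρf φ) + c • ((-s) • n + c • ρf φ) = (c ^ 2 + s ^ 2) • ρf φ := by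
        simp only [hρf]; module
      rw [h1, hcs, one_smul]
    rw [map_smul, real_inner_smul_left, real_inner_comm (pf φ) (fderiv ℝ u (γ φ) (pf φ)), inner_neg_right, hρdec,
      inner_add_right, inner_smul_right, inner_smul_right]
    have hPφ := hP φ
    have hMφ := hMξ φ
    simp only [hρf, inner_add_right, inner_smul_right] at hPφ hMφ ⊢
    linear_combination r * hPφ - a * s * hMφ
  -- integrate over `[0, 2π]`
  have hint : ∫ φ in (0 : ℝ)..2 * Real.pi, (K₀ + K₁ * Real.cos φ + K₂ * Real.sin φ) =
      r * (a * ⟪u (γ (2 * Real.pi)), pf (2 * Real.pi)⟫) - r * (a * ⟪u (γ 0), pf 0⟫) :=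
    intervalIntegral.integral_eq_sub_of_hasDerivAt (fun φ _ => hderiv φ)
      ((by fun_prop : Continuous fun φ => K₀ + K₁ * Real.cos φ + K₂ * Real.sin φ).intervalIntegrable _ _)
  have hper : r * (a * ⟪u (γ (2 * Real.pi)), pf (2 * Real.pi)⟫) - r * (a * ⟪u (γ 0), pf 0⟫) = 0 := by
    simp only [hγ, hpf, Real.cos_two_pi, Real.sin_two_pi, Real.cos_zero, Real.sin_zero, sub_self]
  have hval : ∫ φ in (0 : ℝ)..2 * Real.pi, (K₀ + K₁ * Real.cos φ + K₂ * Real.sin φ) = 2 * Real.pi * K₀ := by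
    rw [intervalIntegral.integral_add, intervalIntegral.integral_add, intervalIntegral.integral_const,
      intervalIntegral.integral_const_mul, intervalIntegral.integral_const_mul, integral_cos, integral_sin]
    · simp only [Real.sin_two_pi, Real.sin_zero, Real.cos_two_pi, Real.cos_zero, sub_self, mul_zero, add_zero,
        sub_zero, smul_eq_mul]
    · exact continuous_const.intervalIntegrable _ _
    · exact (continuous_const.mul Real.continuous_cos).intervalIntegrable _ _
    · exact (continuous_const.add (continuous_const.mul Real.continuous_cos)).intervalIntegrable _ _
    · exact (continuous_const.mul Real.continuous_sin).intervalIntegrable _ _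
  rw [hval, hper] at hint
  have hK : K₀ = 0 := by
    rcases mul_eq_zero.mp hint with h | h
    · exact absurd h (by positivity)
    · exact h
  rw [hK₀] at hK
  rcases mul_eq_zero.mp hK with h | h
  · exact absurd h hθ
  · linear_combination (-1 : ℝ) * h

end Summit.NavierStokesRegularity.NavierStokesRegularity.Theorems.PoloidalLiouville.FluxStarvedDipole

end
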